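import Mathlib
import HarnessLib
import Summits.Ventures.LatticeQCDFlow.Scoring.ChainBurnIn

/-!
# From ANY start: the mean-square error of the time average is the stationary error bar plus an
# explicit `O(1/N²)` price of the start — `E_{μ₀}[(A_N − π f)²] ≤ (2/ε − 1) Var_π f / N + 16 C'²/(ε² N²)`

HONEST FRAMING: exact (Metropolis-corrected) sampling algorithms for lattice gauge theory;
figures of merit are autocorrelation/cost numbers at stated couplings and volumes; no
continuum-physics claim.

Venture `LatticeQCDFlow` (cell pub-lqcd), topic `Scoring`; FANOUT row 8 (`s0-cpn-nemc`, GEN-13).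
NEW WORK of the cell, not a published result; no definition is introduced.  The two halves of the
row's error-bar story for the simulated chain (Mathlib's `Kernel.trajMeasure` of the homogeneous
Markov chain with kernel `κ`) were: `Scoring/ChainTimeAverage.lean` — started IN the invariant law
`π`, `Var[(1/N) Σ_{i<N} f(X_i)] ≤ (2/ε − 1) Var_π f / N` under Doeblin by `π`; and
`Scoring/ChainBurnIn.lean` — from ANY initial law `μ₀`, the BIAS of the time average is
`≤ 2(C + |πf|)/(εN)`.  This file closes the square: from any start the full MEAN-SQUARE ERROR about
the true mean `π f` is the stationary bound plus a term of order `1/N²` — thermalisation costs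
nothing at leading order, with an explicit constant.  Inputs: `chain_twoTime` / `chain_expect`
(parents), the sup-norm decay `|(kop κ)^[t] g| ≤ (1 − ε/2)ᵗ C` of centred observables
(`Scoring/DoeblinGreenKubo.lean`), the `L²` envelope `|C_g(t)| ≤ (1 − ε)ᵗ Var_π f`
(`Scoring/DoeblinAutocorrelation.lean`) and row 11's pair count (`Scoring/VarianceOfTheMean.lean`).
Printed counterpart NAMED ONLY: non-asymptotic MSE bounds for uniformly ergodic chains from a
non-stationary start (e.g. Łatuszyński–Miasojedow–Niemiro 2013, Bernoulli 19; Paulin 2015, EJP 20 —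
named, not restated, not cited as facts).

## Content (`κ` Markov, `π` invariant probability law, DOEBLIN BY `π`: `κ(x, ·) ≥ ε π`, `ε > 0`;
## `μ₀` ANY probability law; `P_{μ₀}` the trajectory law; `f` bounded measurable, `|f| ≤ C`,
## `C' = C + |πf|`, `g = f − πf`, `C_g(t) = autocov κ π g t`, `r = 1 − ε/2`)

* `sum_sum_max`, `sum_range_odd_mul_pow_le` — pair count by the larger index:
  `Σ_{i,j<N} F(max i j) = Σ_{k<N} (2k+1) F(k)` and `Σ_{k<N} (2k+1) rᵏ ≤ (1 + r)/(1 − r)²`;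
* **`chain_twoTime_initial`** — two-time moments from any start:
  `E_{μ₀}[g(X_s) f(X_{s+t})] = ∫ (kop κ)^[s] (g · (kop κ)^[t] f) dμ₀`;
* **`abs_chain_twoTime_sub_autocov_le_of_doeblin`** — the start is forgotten geometrically in BOTH
  indices: `|E_{μ₀}[g(X_s) g(X_{s+t})] − C_g(t)| ≤ 2C'² r^{s+t}`; `abs_chain_pair_sub_autocov_le_of_doeblin`
  — the same as `≤ 2C'² r^{max i j}` for every pair of times;
* `chain_sqError_timeAverage_eq` — `E_{μ₀}[(A_N − m)²] = (1/N²) Σ_{i,j<N} E_{μ₀}[(f(X_i) − m)(f(X_j) − m)]`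
  for every constant `m` (`A_N = (1/N) Σ_{i<N} f(X_i)`);
* **`chain_mse_le_of_doeblin`** — THE BOUND: for every initial law `μ₀`, every bounded measurable
  `f` and every `N ≥ 1`,
  `E_{μ₀}[(A_N − πf)²] ≤ (2/ε − 1) · Var_π f / N + 16 (C + |πf|)² / (ε² N²)`.

Reading (value-free): an exact sampler with a Doeblin certificate needs no separate thermalisation
argument for its error bars — started from any configuration (cold, hot, a model draw), the
mean-square error of a bounded observable's time average is the stationary `(2/ε − 1) Var_π f / N`
plus a second-order term whose constant is explicit in `ε` and the observable's range.  NOT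
CLAIMED: any `ε` for a concrete sampler; unbounded observables; the Γ-method estimator; optimality
of the constant `16/ε²`.
-/

noncomputable section

namespace Summit.Ventures.LatticeQCDFlow.Scoring

open MeasureTheory ProbabilityTheory Filter Finset Preorder
open scoped ENNReal

variable {Ω : Type*} [MeasurableSpace Ω]

/-! ### Pair count by the larger index -/

section Pairs

/-- `Σ_{i<N} Σ_{j<N} F(max i j) = Σ_{k<N} (2k + 1) F(k)` (there are `2k + 1` ordered pairs with
larger index `k`). -/
theorem sum_sum_max (F : ℕ → ℝ) : ∀ N : ℕ,
    ∑ i ∈ range N, ∑ j ∈ range N, F (max i j) = ∑ k ∈ range N, (2 * (k : ℝ) + 1) * F k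
  | 0 => by simp
  | N + 1 => by
    have h1 : ∀ i ∈ range N, F (max i N) = F N := fun i hi => by
      rw [max_eq_right (Finset.mem_range.1 hi).le]
    have h2 : ∀ j ∈ range N, F (max N j) = F N := fun j hj => by
      rw [max_eq_left (Finset.mem_range.1 hj).le]
    simp_rw [Finset.sum_range_succ]
    rw [Finset.sum_add_distrib, sum_sum_max F N, Finset.sum_congr rfl h1, Finset.sum_congr rfl h2,
      max_self, Finset.sum_const, Finset.card_range, nsmul_eq_mul]
    ring

/-- `Σ_{k<N} (2k + 1) rᵏ ≤ (1 + r)/(1 − r)²` for `0 ≤ r < 1`. -/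
theorem sum_range_odd_mul_pow_le {r : ℝ} (hr0 : 0 ≤ r) (hr1 : r < 1) (N : ℕ) :
    ∑ k ∈ range N, (2 * (k : ℝ) + 1) * r ^ k ≤ (1 + r) / (1 - r) ^ 2 := by
  have hnorm : ‖r‖ < 1 := by rw [Real.norm_eq_abs, abs_of_nonneg hr0]; exact hr1
  have hA := hasSum_coe_mul_geometric_of_norm_lt_one hnorm
  have hB := hasSum_geometric_of_lt_one hr0 hr1
  have hAB : HasSum (fun k : ℕ => (2 * (k : ℝ) + 1) * r ^ k)
      (2 * (r / (1 - r) ^ 2) + (1 - r)⁻¹) := by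
    have h := (hA.mul_left 2).add hB
    have hfun : (fun k : ℕ => (2 * (k : ℝ) + 1) * r ^ k)
        = fun k : ℕ => 2 * ((k : ℝ) * r ^ k) + r ^ k := by
      funext k
      ring
    rw [hfun]
    exact h
  have hle := sum_le_hasSum (range N) (fun k _ => by positivity) hAB
  have h1r : 0 < 1 - r := by linarith
  calc ∑ k ∈ range N, (2 * (k : ℝ) + 1) * r ^ k ≤ 2 * (r / (1 - r) ^ 2) + (1 - r)⁻¹ := hle
    _ = (1 + r) / (1 - r) ^ 2 := by
        field_simp
        ring

end Pairs

/-! ### Two-time moments from an arbitrary start -/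

section Chain

variable (κ : Kernel Ω Ω) [IsMarkovKernel κ] (μ₀ : Measure Ω) [IsProbabilityMeasure μ₀]

/-- **Two-time moments from any start**: for bounded measurable `f, g` and all `s, t`,
`E_{μ₀}[g(X_s) f(X_{s+t})] = ∫ (kop κ)^[s] (g · (kop κ)^[t] f) dμ₀`. -/
theorem chain_twoTime_initial (s t : ℕ) {f g : Ω → ℝ} (hf : Measurable f) {Cf : ℝ}
    (hCf : ∀ x, |f x| ≤ Cf) (hg : Measurable g) {Cg : ℝ} (hCg : ∀ x, |g x| ≤ Cg) :
    ∫ x, g (x s) * f (x (s + t)) ∂(Kernel.trajMeasure (X := fun _ : ℕ => Ω) μ₀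
        (fun n : ℕ => κ.comap (fun h : (i : ↥(Finset.Iic n)) → Ω => h ⟨n, Finset.mem_Iic.2 le_rfl⟩)
          (measurable_pi_apply _)))
      = ∫ y, (kop κ)^[s] (fun z => g z * (kop κ)^[t] f z) y ∂μ₀ := by
  obtain ⟨hm, hb⟩ := iterate_kop_bounded_measurable κ hf hCf t
  rw [chain_twoTime κ μ₀ s hg hCg t hf hCf]
  exact chain_expect κ μ₀ (f := fun z => g z * (kop κ)^[t] f z) (hg.mul hm) (C := Cg * Cf)
    (fun x => by
      rw [abs_mul]
      exact mul_le_mul (hCg x) (hb x) (abs_nonneg _) ((abs_nonneg _).trans (hCg x))) s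

variable {κ μ₀}

/-- **The start is forgotten geometrically in both indices.**  With `π` invariant, `κ(x, ·) ≥ ε π`
(`ε > 0`) and a bounded measurable `π`-centred `g` (`|g| ≤ C`): for every initial law `μ₀` and all
`s, t`, `|E_{μ₀}[g(X_s) g(X_{s+t})] − autocov κ π g t| ≤ 2 C² (1 − ε/2)^{s+t}`. -/
theorem abs_chain_twoTime_sub_autocov_le_of_doeblin {π : Measure Ω} [IsProbabilityMeasure π]
    (hπ : Kernel.Invariant κ π) {ε : ℝ≥0∞}
    (hmin : ∀ x {B : Set Ω}, MeasurableSet B → ε * π B ≤ κ x B) (hε0 : 0 < ε)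
    {g : Ω → ℝ} (hg : Measurable g) {C : ℝ} (hC : ∀ x, |g x| ≤ C) (hg0 : ∫ x, g x ∂π = 0)
    (s t : ℕ) :
    |∫ x, g (x s) * g (x (s + t)) ∂(Kernel.trajMeasure (X := fun _ : ℕ => Ω) μ₀
        (fun n : ℕ => κ.comap (fun h : (i : ↥(Finset.Iic n)) → Ω => h ⟨n, Finset.mem_Iic.2 le_rfl⟩)
          (measurable_pi_apply _))) - autocov κ π g t|
      ≤ 2 * C ^ 2 * (1 - (ε / 2).toReal) ^ (s + t) := by
  obtain ⟨-, hl0, -, -, -, -⟩ := half_const_bounds hmin hε0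
  obtain ⟨hKm, hKb⟩ := iterate_kop_bounded_measurable κ hg hC t
  have hdec : ∀ z, |(kop κ)^[t] g z| ≤ (1 - (ε / 2).toReal) ^ t * C := fun z =>
    abs_iterate_kop_le_of_doeblin hπ hmin hε0 hg hC hg0 t z
  have hC0 : 0 ≤ C := by
    obtain ⟨x⟩ := nonempty_of_isProbabilityMeasure π
    exact (abs_nonneg _).trans (hC x)
  -- the lag-`t` observable `h = g · K^t g`, its bound `B` and its `π`-mean `autocov κ π g t`
  set B := C * ((1 - (ε / 2).toReal) ^ t * C) with hB
  have hhm : Measurable (fun z => g z * (kop κ)^[t] g z) := hg.mul hKm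
  have hhb : ∀ z, |g z * (kop κ)^[t] g z| ≤ B := fun z => by
    rw [abs_mul]; exact mul_le_mul (hC z) (hdec z) (abs_nonneg _) hC0
  have hπh : ∫ z, g z * (kop κ)^[t] g z ∂π = autocov κ π g t := rfl
  have hπh_le : |autocov κ π g t| ≤ B := by
    rw [← hπh]
    calc |∫ z, g z * (kop κ)^[t] g z ∂π| = ‖∫ z, g z * (kop κ)^[t] g z ∂π‖ :=
          (Real.norm_eq_abs _).symm
      _ ≤ B * π.real Set.univ := norm_integral_le_of_norm_le_const (Eventually.of_forall fun z => by
          rw [Real.norm_eq_abs]; exact hhb z)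
      _ = B := by rw [probReal_univ, mul_one]
  -- its centred version
  have hcm : Measurable (fun z => g z * (kop κ)^[t] g z - autocov κ π g t) :=
    hhm.sub measurable_const
  have hcb : ∀ z, |g z * (kop κ)^[t] g z - autocov κ π g t| ≤ 2 * B := fun z =>
    (abs_sub _ _).trans (by linarith [hhb z, hπh_le])
  have hc0 : ∫ z, (g z * (kop κ)^[t] g z - autocov κ π g t) ∂π = 0 := by
    rw [integral_sub (integrable_of_bounded π hhm hhb) (integrable_const _), integral_const,
      probReal_univ, one_smul, hπh, sub_self]
  -- `E[g_s g_{s+t}] − C(t) = ∫ K^s (h − C(t)) dμ₀`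
  have hrepr : ∫ x, g (x s) * g (x (s + t)) ∂(Kernel.trajMeasure (X := fun _ : ℕ => Ω) μ₀
        (fun n : ℕ => κ.comap (fun h : (i : ↥(Finset.Iic n)) → Ω => h ⟨n, Finset.mem_Iic.2 le_rfl⟩)
          (measurable_pi_apply _))) - autocov κ π g t
      = ∫ y, (kop κ)^[s] (fun z => g z * (kop κ)^[t] g z - autocov κ π g t) y ∂μ₀ := by
    obtain ⟨hsm, hsb⟩ := iterate_kop_bounded_measurable κ hhm hhb s
    rw [chain_twoTime_initial κ μ₀ s t hg hC hg hC, iterate_kop_sub_const (κ := κ) hhm hhb _ s,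
      integral_sub (integrable_of_bounded μ₀ hsm hsb) (integrable_const _), integral_const,
      probReal_univ, one_smul]
  rw [hrepr]
  calc |∫ y, (kop κ)^[s] (fun z => g z * (kop κ)^[t] g z - autocov κ π g t) y ∂μ₀|
      = ‖∫ y, (kop κ)^[s] (fun z => g z * (kop κ)^[t] g z - autocov κ π g t) y ∂μ₀‖ :=
        (Real.norm_eq_abs _).symm
    _ ≤ (1 - (ε / 2).toReal) ^ s * (2 * B) * μ₀.real Set.univ :=
        norm_integral_le_of_norm_le_const (Eventually.of_forall fun y => by
          rw [Real.norm_eq_abs]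
          exact abs_iterate_kop_le_of_doeblin hπ hmin hε0 hcm hcb hc0 s y)
    _ = 2 * C ^ 2 * (1 - (ε / 2).toReal) ^ (s + t) := by
        rw [probReal_univ, mul_one, hB, pow_add]; ring

/-- The same for every ordered pair of times: `|E_{μ₀}[g(X_i) g(X_j)] − C_g(|i − j|)| ≤
2 C² (1 − ε/2)^{max i j}`. -/
theorem abs_chain_pair_sub_autocov_le_of_doeblin {π : Measure Ω} [IsProbabilityMeasure π]
    (hπ : Kernel.Invariant κ π) {ε : ℝ≥0∞}
    (hmin : ∀ x {B : Set Ω}, MeasurableSet B → ε * π B ≤ κ x B) (hε0 : 0 < ε)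
    {g : Ω → ℝ} (hg : Measurable g) {C : ℝ} (hC : ∀ x, |g x| ≤ C) (hg0 : ∫ x, g x ∂π = 0)
    (i j : ℕ) :
    |∫ x, g (x i) * g (x j) ∂(Kernel.trajMeasure (X := fun _ : ℕ => Ω) μ₀
        (fun n : ℕ => κ.comap (fun h : (i : ↥(Finset.Iic n)) → Ω => h ⟨n, Finset.mem_Iic.2 le_rfl⟩)
          (measurable_pi_apply _))) - autocov κ π g (Nat.dist i j)|
      ≤ 2 * C ^ 2 * (1 - (ε / 2).toReal) ^ (max i j) := by
  rcases le_total i j with hij | hji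
  · obtain ⟨t, rfl⟩ := Nat.exists_eq_add_of_le hij
    rw [Nat.dist_eq_sub_of_le hij, Nat.add_sub_cancel_left, max_eq_right hij]
    exact abs_chain_twoTime_sub_autocov_le_of_doeblin hπ hmin hε0 hg hC hg0 i t
  · obtain ⟨t, rfl⟩ := Nat.exists_eq_add_of_le hji
    rw [Nat.dist_eq_sub_of_le_right hji, Nat.add_sub_cancel_left, max_eq_left hji]
    have hcomm : ∫ x, g (x (j + t)) * g (x j) ∂(Kernel.trajMeasure (X := fun _ : ℕ => Ω) μ₀
        (fun n : ℕ => κ.comap (fun h : (i : ↥(Finset.Iic n)) → Ω => h ⟨n, Finset.mem_Iic.2 le_rfl⟩)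
          (measurable_pi_apply _)))
        = ∫ x, g (x j) * g (x (j + t)) ∂(Kernel.trajMeasure (X := fun _ : ℕ => Ω) μ₀
        (fun n : ℕ => κ.comap (fun h : (i : ↥(Finset.Iic n)) → Ω => h ⟨n, Finset.mem_Iic.2 le_rfl⟩)
          (measurable_pi_apply _))) :=
      integral_congr_ae (ae_of_all _ fun x => mul_comm _ _)
    rw [hcomm]
    exact abs_chain_twoTime_sub_autocov_le_of_doeblin hπ hmin hε0 hg hC hg0 j t

/-! ### The mean-square error of the time average -/

/-- The squared error of the time average about any constant `m` is a double sum of two-time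
moments: `E_{μ₀}[((1/N) Σ_{i<N} f(X_i) − m)²] = (1/N²) Σ_{i,j<N} E_{μ₀}[(f(X_i) − m)(f(X_j) − m)]`. -/
theorem chain_sqError_timeAverage_eq {f : Ω → ℝ} (hf : Measurable f) {C : ℝ} (hC : ∀ x, |f x| ≤ C)
    (m : ℝ) {N : ℕ} (hN : N ≠ 0) :
    ∫ x, ((∑ i ∈ Finset.range N, f (x i)) / N - m) ^ 2 ∂(Kernel.trajMeasure (X := fun _ : ℕ => Ω) μ₀
        (fun n : ℕ => κ.comap (fun h : (i : ↥(Finset.Iic n)) → Ω => h ⟨n, Finset.mem_Iic.2 le_rfl⟩)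
          (measurable_pi_apply _)))
      = (∑ i ∈ Finset.range N, ∑ j ∈ Finset.range N,
          ∫ x, (f (x i) - m) * (f (x j) - m) ∂(Kernel.trajMeasure (X := fun _ : ℕ => Ω) μ₀
            (fun n : ℕ => κ.comap (fun h : (i : ↥(Finset.Iic n)) → Ω => h ⟨n, Finset.mem_Iic.2 le_rfl⟩)
              (measurable_pi_apply _)))) / (N : ℝ) ^ 2 := by
  set P := Kernel.trajMeasure (X := fun _ : ℕ => Ω) μ₀
      (fun n : ℕ => κ.comap (fun h : (i : ↥(Finset.Iic n)) → Ω => h ⟨n, Finset.mem_Iic.2 le_rfl⟩)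
        (measurable_pi_apply _)) with hP
  have hN' : (N : ℝ) ≠ 0 := by exact_mod_cast hN
  have hgb : ∀ y, |f y - m| ≤ C + |m| := fun y => (abs_sub _ _).trans (add_le_add (hC y) le_rfl)
  have hint : ∀ i j, Integrable (fun x : ℕ → Ω => (f (x i) - m) * (f (x j) - m)) P := fun i j =>
    integrable_of_bounded P
      (((hf.comp (measurable_pi_apply i)).sub measurable_const).mul
        ((hf.comp (measurable_pi_apply j)).sub measurable_const)) (C := (C + |m|) * (C + |m|))
      fun x => by
        rw [abs_mul]
        exact mul_le_mul (hgb _) (hgb _) (abs_nonneg _) ((abs_nonneg _).trans (hgb (x i)))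
  have hpt : ∀ x : ℕ → Ω, ((∑ i ∈ Finset.range N, f (x i)) / N - m) ^ 2
      = (∑ i ∈ Finset.range N, ∑ j ∈ Finset.range N, (f (x i) - m) * (f (x j) - m)) / (N : ℝ) ^ 2 := by
    intro x
    have h1 : (∑ i ∈ Finset.range N, f (x i)) / N - m = (∑ i ∈ Finset.range N, (f (x i) - m)) / N := by
      rw [Finset.sum_sub_distrib, Finset.sum_const, Finset.card_range, nsmul_eq_mul]
      field_simp
    rw [h1, div_pow, sq (∑ i ∈ Finset.range N, (f (x i) - m)), Finset.sum_mul_sum]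
  rw [integral_congr_ae (ae_of_all _ hpt), integral_div, integral_finsetSum _ fun i _ =>
    integrable_finsetSum _ fun j _ => hint i j]
  congr 1
  exact Finset.sum_congr rfl fun i _ => integral_finsetSum _ fun j _ => hint i j

/-- **THE MEAN-SQUARE ERROR FROM ANY START.**  Let `π` be an invariant probability law of the Markov
kernel `κ` with `κ(x, ·) ≥ ε π` (`ε > 0`).  For EVERY initial law `μ₀`, every bounded measurable `f`
(`|f| ≤ C`) and every `N ≥ 1`, the chain `X_0, X_1, …` with kernel `κ` started in `μ₀` satisfies
`E_{μ₀}[((1/N) Σ_{i<N} f(X_i) − ∫ f dπ)²] ≤ (2/ε − 1) · Var_π f / N + 16 (C + |∫ f dπ|)² / (ε² N²)`. -/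
theorem chain_mse_le_of_doeblin {π : Measure Ω} [IsProbabilityMeasure π] (hπ : Kernel.Invariant κ π)
    {ε : ℝ≥0∞} (hmin : ∀ x {B : Set Ω}, MeasurableSet B → ε * π B ≤ κ x B) (hε0 : 0 < ε)
    {f : Ω → ℝ} (hf : Measurable f) {C : ℝ} (hC : ∀ x, |f x| ≤ C) {N : ℕ} (hN : N ≠ 0) :
    ∫ x, ((∑ i ∈ Finset.range N, f (x i)) / N - ∫ z, f z ∂π) ^ 2
        ∂(Kernel.trajMeasure (X := fun _ : ℕ => Ω) μ₀
          (fun n : ℕ => κ.comap (fun h : (i : ↥(Finset.Iic n)) → Ω => h ⟨n, Finset.mem_Iic.2 le_rfl⟩)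
            (measurable_pi_apply _)))
      ≤ (2 / ε.toReal - 1) * autocov κ π (fun y => f y - ∫ z, f z ∂π) 0 / N
        + 16 * (C + |∫ z, f z ∂π|) ^ 2 / (ε.toReal ^ 2 * (N : ℝ) ^ 2) := by
  set P := Kernel.trajMeasure (X := fun _ : ℕ => Ω) μ₀
      (fun n : ℕ => κ.comap (fun h : (i : ↥(Finset.Iic n)) → Ω => h ⟨n, Finset.mem_Iic.2 le_rfl⟩)
        (measurable_pi_apply _)) with hP
  set m := ∫ z, f z ∂π with hm
  set g := fun y => f y - m with hg
  have hgm : Measurable g := hf.sub measurable_const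
  have hgb : ∀ y, |g y| ≤ C + |m| := fun y => (abs_sub _ _).trans (add_le_add (hC y) le_rfl)
  have hg0 : ∫ y, g y ∂π = 0 := by
    rw [hg, integral_sub (integrable_of_bounded π hf hC) (integrable_const _), integral_const,
      probReal_univ, one_smul, hm, sub_self]
  obtain ⟨-, hl0, hl1, -, hr, hεr0⟩ := half_const_bounds hmin hε0
  have hε1 := eps_le_one_of_doeblin hmin
  have hk0 : 0 ≤ 1 - ε.toReal := one_sub_toReal_nonneg_of_doeblin hmin
  have hk1 : 1 - ε.toReal < 1 := by linarith
  have hNpos : (0 : ℝ) < N := by exact_mod_cast Nat.pos_of_ne_zero hN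
  have hσ0 : 0 ≤ autocov κ π g 0 := by rw [autocov_zero]; exact integral_nonneg fun _ => sq_nonneg _
  -- (1) the squared error as a double sum of two-time moments `e i j`
  have hsq := chain_sqError_timeAverage_eq (κ := κ) (μ₀ := μ₀) hf hC m hN
  rw [← hP] at hsq
  -- (2) each two-time moment is within `2 C'² r^{max i j}` of `C_g(|i − j|)`
  have hpair : ∀ i j, ∫ x, g (x i) * g (x j) ∂P
      ≤ autocov κ π g (Nat.dist i j) + 2 * (C + |m|) ^ 2 * (1 - (ε / 2).toReal) ^ (max i j) := by
    intro i j
    have h := abs_chain_pair_sub_autocov_le_of_doeblin (μ₀ := μ₀) hπ hmin hε0 hgm hgb hg0 i j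
    rw [← hP] at h
    linarith [(abs_le.1 h).2]
  -- (3) the stationary double sum is at most `N (2/ε − 1) C_g(0)`
  have henv : ∀ t, |autocov κ π g t| ≤ (1 - ε.toReal) ^ t * autocov κ π g 0 := fun t => by
    rw [autocov_zero]; exact abs_autocov_le_of_doeblin hπ hmin hgm hgb hg0 t
  have hstat : ∑ i ∈ Finset.range N, ∑ j ∈ Finset.range N, autocov κ π g (Nat.dist i j)
      ≤ N * ((2 / ε.toReal - 1) * autocov κ π g 0) := by
    rw [sum_sum_dist]
    have hterm : ∀ t ∈ Finset.range N, ((N : ℝ) - (t + 1)) * autocov κ π g (t + 1)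
        ≤ N * ((1 - ε.toReal) ^ (t + 1) * autocov κ π g 0) := by
      intro t ht
      have ht' : (t : ℝ) + 1 ≤ N := by exact_mod_cast Finset.mem_range.1 ht
      have h1 : ((N : ℝ) - (t + 1)) * autocov κ π g (t + 1)
          ≤ ((N : ℝ) - (t + 1)) * |autocov κ π g (t + 1)| :=
        mul_le_mul_of_nonneg_left (le_abs_self _) (by linarith)
      have h2 : ((N : ℝ) - (t + 1)) * |autocov κ π g (t + 1)| ≤ N * |autocov κ π g (t + 1)| :=
        mul_le_mul_of_nonneg_right (by linarith) (abs_nonneg _)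
      exact h1.trans (h2.trans (mul_le_mul_of_nonneg_left (henv (t + 1)) hNpos.le))
    have hlag : ∑ t ∈ Finset.range N, ((N : ℝ) - (t + 1)) * autocov κ π g (t + 1)
        ≤ N * ((1 / ε.toReal - 1) * autocov κ π g 0) := by
      refine (Finset.sum_le_sum hterm).trans ?_
      rw [← Finset.mul_sum, ← Finset.sum_mul]
      refine mul_le_mul_of_nonneg_left (mul_le_mul_of_nonneg_right ?_ hσ0) hNpos.le
      have habs : |1 - ε.toReal| < 1 := by rw [abs_of_nonneg hk0]; exact hk1
      have hs := sum_le_hasSum (Finset.range N) (fun t _ => pow_nonneg hk0 (t + 1))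
        (hasSum_geometric_succ habs)
      have hε' : (1 - ε.toReal) / (1 - (1 - ε.toReal)) = 1 / ε.toReal - 1 := by
        rw [sub_sub_cancel, sub_div, div_self hεr0.ne']
      linarith
    have h2 : (N : ℝ) * ((2 / ε.toReal - 1) * autocov κ π g 0)
        = N * autocov κ π g 0 + 2 * (N * ((1 / ε.toReal - 1) * autocov κ π g 0)) := by ring
    rw [h2]
    linarith
  -- (4) the correction double sum is at most `8/ε²`
  have hcorr : ∑ i ∈ Finset.range N, ∑ j ∈ Finset.range N, (1 - (ε / 2).toReal) ^ (max i j)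
      ≤ 8 / ε.toReal ^ 2 := by
    rw [sum_sum_max (fun k => (1 - (ε / 2).toReal) ^ k) N]
    refine (sum_range_odd_mul_pow_le hl0 hl1 N).trans ?_
    rw [hr, show 1 - (1 - ε.toReal / 2) = ε.toReal / 2 by ring, div_le_div_iff₀ (by positivity)
      (by positivity)]
    nlinarith [hεr0, sq_nonneg ε.toReal]
  -- (5) assemble
  have hsum : ∑ i ∈ Finset.range N, ∑ j ∈ Finset.range N, ∫ x, g (x i) * g (x j) ∂P
      ≤ N * ((2 / ε.toReal - 1) * autocov κ π g 0) + 2 * (C + |m|) ^ 2 * (8 / ε.toReal ^ 2) := by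
    calc ∑ i ∈ Finset.range N, ∑ j ∈ Finset.range N, ∫ x, g (x i) * g (x j) ∂P
        ≤ ∑ i ∈ Finset.range N, ∑ j ∈ Finset.range N,
            (autocov κ π g (Nat.dist i j) + 2 * (C + |m|) ^ 2 * (1 - (ε / 2).toReal) ^ (max i j)) :=
          Finset.sum_le_sum fun i _ => Finset.sum_le_sum fun j _ => hpair i j
      _ = ∑ i ∈ Finset.range N, ∑ j ∈ Finset.range N, autocov κ π g (Nat.dist i j)
          + 2 * (C + |m|) ^ 2
            * ∑ i ∈ Finset.range N, ∑ j ∈ Finset.range N, (1 - (ε / 2).toReal) ^ (max i j) := by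
          rw [Finset.mul_sum, ← Finset.sum_add_distrib]
          refine Finset.sum_congr rfl fun i _ => ?_
          rw [Finset.mul_sum, ← Finset.sum_add_distrib]
      _ ≤ N * ((2 / ε.toReal - 1) * autocov κ π g 0) + 2 * (C + |m|) ^ 2 * (8 / ε.toReal ^ 2) :=
          add_le_add hstat (mul_le_mul_of_nonneg_left hcorr (by positivity))
  have hgoal : ∫ x, ((∑ i ∈ Finset.range N, f (x i)) / N - m) ^ 2 ∂P
      = (∑ i ∈ Finset.range N, ∑ j ∈ Finset.range N, ∫ x, g (x i) * g (x j) ∂P) / (N : ℝ) ^ 2 := hsq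
  rw [hgoal, div_le_iff₀ (by positivity)]
  rw [show ((2 / ε.toReal - 1) * autocov κ π g 0 / N + 16 * (C + |m|) ^ 2 / (ε.toReal ^ 2 * (N : ℝ) ^ 2))
      * (N : ℝ) ^ 2 = N * ((2 / ε.toReal - 1) * autocov κ π g 0) + 2 * (C + |m|) ^ 2 * (8 / ε.toReal ^ 2) by
    field_simp; ring]
  exact hsum

end Chain

end Summit.Ventures.LatticeQCDFlow.Scoring

end
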